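import Summits.QuantumFields.BalabanUV.Beta.VhPieceReflection

/-!
# The vh-SLICE law at EVERY LEVEL: `c • vhSAt ρ_c` obeys the socket shape (Sr-conj) against ANY kernel `𝕄` whose border is
# `s •` the border of `bhKAt ρ_c Lc` and whose multiplier block vanishes — contact `(c / (s·Lc^{d+1})) • diagK (ctGen d α Lc κ′ u)`
# (β sub-cell, row BETA-an2, gen 14; NOTE X-an2-45 §3 / (R45-4); the vh third of hSrC at `j ≥ 1` pre-executed modulo the binder `𝕄_j`)

HONEST FRAMING (cell charter, verbatim): «discharging BetaPertH makes Balaban's UV stability UNCONDITIONAL — a real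
constructive-QFT result; it is NOT the continuum limit and NOT the Clay problem.»  DERIVED cell leaf (pub-balaban β sub-cell, lane
an2 gen 14); no statement of Bałaban's papers is typed here, no `[cite:]` tag, no `Prop` fact; it instantiates no binder of the
β-function wall by itself.  The kernel `𝕄` is an explicit PARAMETER with three entrywise hypotheses; nothing is asserted about the
binder `𝕄_j` of `SpineRooted.axisReflectionCovariant_flipK_TbalOf_JsBalBm(N)AtOf_ctrC`.  NOT `BetaPertH`; NOT continuum; NOT Clay.

## What is here ([folklore] bookkeeping over `VhPieceReflection` / `DiagonalContact` / an5's `RootedKernelReflection.vhSAt_bref`)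

Fix `Lc` odd, the centred root `ρ_c = ctr (d+1) Lc`, a scalar `c`, a scalar `s ≠ 0` and a kernel `𝕄` with
(fm) `𝕄 x z (inl β) (inr μ) = s · bhKAt d ρ_c Lc x z (inl β) (inr μ)`, (mf) `𝕄 x z (inr μ) (inl β) = s · bhKAt d ρ_c Lc x z (inr μ) (inl β)`,
(mm) `𝕄 x z (inr μ) (inr μ′) = 0` — the SHAPE of an4-g33's candidate `𝕄_j = [[T_j, −M^{d+2}𝒬ᵀ],[M^{d+2}𝒬, 0]]` (`s = M^{d+2}`, any field block
`T_j`; at `j = 0`, `𝕄 = bhKAt`, `s = 1`).  Then, with `C := (c / (s·Lc^{d+1})) • diagK (ctGen d α Lc κ′ u)`: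
* `conjV_diagK_apply_of_entry` (entries of `conjV 𝕄 (diagK g)` where `𝕄` is `s ·` an entry of `bhKAt`), `conjV_diagK_ctGen_inl_inl_of_ne'`
  (the field–field block of `conjV 𝕄 (diagK ctGen)` vanishes for `κ′ ≠ α`, ANY `𝕄`), `conjV_diagK_inr_inr_of_mm` (the mm block vanishes);
* blockwise laws `smul_vhSAt_bref_inl_inr` / `_inr_inl` / `_inr_inr` (every jet bond) and `_inl_inl_of_ne` (`κ′ ≠ α`);
* **`smul_vhSAt_bref_of_ne`**: for `κ′ ≠ α`,
  `c • vhSAt ρ_c d Lc rfl κ′ (bref α κ′ u) = reflSign α κ′ • refK (Φ Lc α) (c • vhSAt ρ_c d Lc rfl κ′ u + conjV 𝕄 C)`.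
READING (asserted nowhere): the vh summand of `SstepNAt ρ_c cE cVH cΛ j` is `(cVH·wVH d Lc j) • vhSAt ρ_c d Lc rfl` (`wVH j = (Lc^j)^{2(d+2)}`),
so at every level the vh third of the socket hSrC holds against any such `𝕄_j` with the contact family
`C j α κ′ u := (cVH·wVH d Lc j / (s_j·Lc^{d+1})) • diagK (ctGen d α Lc κ′ u)`; for `κ′ = α` the field–field block of `conjV 𝕄_j (C j α κ′ u)` is
`T_j(x,z)·(coefficient)·([x = u ∧ a = κ′] − [z = u ∧ b = κ′])` (`conjV_diagK_apply`, `ctGen_inl`) — the contact the value-function summand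
`e3NAtOf j` must absorb (the level-`j` analogue of the Wilson law with contact).  All declarations `[folklore]`; axioms standard.
Provenance: b2b-balaban β sub-cell, unit beta-an2 gen 14, 2026-08-20 (v1); no existing file touched.
-/

open Finset
open scoped BigOperators
open Literature.MathematicalPhysics.QuantumFieldTheory
open Literature.MathematicalPhysics.QuantumFieldTheory.Balaban1983to89
open Literature.MathematicalPhysics.QuantumFieldTheory.Balaban1983to89.Beta
open ExpKernelCalculus (MKer comp)
open AveragingContoursRooted (ctr ctrOff)
open AveragingHessianKernels (packVH packVH_inl_inl packVH_inr_inr packVH_inl_inr packVH_inr_inl)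
open AveragingHessianKernelsRooted (vhSAt)
open RootedKernelReflection (ctE vhSAt_bref)
open PolarizationSign (reflSign)
open KernelReflection (LegMap refK refK_apply)
open ResolventReflection (bref Φ Φ_r_inl Φ_r_inr Φ_s_inl Φ_s_inr)
open OneStepResolventKernel (Fib)
open Summit.QuantumFields.BalabanUV.Beta.ChartConjugation (conjV)
open Summit.QuantumFields.BalabanUV.Beta.BorderedHessian (bhKAt diagK ctGen ctGen_inl conjV_diagK_apply conjV_bhKAt_ctGen_inl_inr
  conjV_bhKAt_ctGen_inr_inl)

noncomputable section

namespace Summit.QuantumFields.BalabanUV.Beta.SpineRooted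

variable {d : ℕ} {Lc : ℕ} [NeZero Lc]

/-! ## §1 Entries of the diagonal contact against a kernel of bordered shape -/

omit [NeZero Lc] in
/-- [folklore] Where `𝕄` is `s ·` an entry of `bhKAt ρ_c Lc`, the diagonal contact is `s ·` that of `bhKAt ρ_c Lc`. -/
theorem conjV_diagK_apply_of_entry {𝕄 : MKer (d + 1) (Fib d)} {s : ℝ} (g : (Fin (d + 1) → ℤ) → Fib d → ℝ)
    {x z : Fin (d + 1) → ℤ} {a b : Fib d} (h : 𝕄 x z a b = s * bhKAt d (ctr (d + 1) Lc) Lc x z a b) :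
    conjV 𝕄 (diagK g) x z a b = s * conjV (bhKAt d (ctr (d + 1) Lc) Lc) (diagK g) x z a b := by
  rw [conjV_diagK_apply, conjV_diagK_apply, h, mul_assoc]

omit [NeZero Lc] in
/-- [folklore] The field–field block of `conjV 𝕄 (diagK (ctGen d α Lc κ′ u))` vanishes for `κ′ ≠ α`, for ANY `𝕄`. -/
theorem conjV_diagK_ctGen_inl_inl_of_ne' (𝕄 : MKer (d + 1) (Fib d)) {α κ' : Fin (d + 1)} (h : κ' ≠ α)
    (u x z : Fin (d + 1) → ℤ) (β β' : Fin (d + 1)) :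
    conjV 𝕄 (diagK (ctGen d α Lc κ' u)) x z (Sum.inl β) (Sum.inl β') = 0 := by
  have h1 : ctGen d α Lc κ' u x (Sum.inl β) = 0 := by
    rw [ctGen_inl, if_neg]
    rintro ⟨-, -, e⟩
    exact h e
  have h2 : ctGen d α Lc κ' u z (Sum.inl β') = 0 := by
    rw [ctGen_inl, if_neg]
    rintro ⟨-, -, e⟩
    exact h e
  rw [conjV_diagK_apply, h1, h2, sub_zero, mul_zero]

/-- [folklore] The multiplier–multiplier block of `conjV 𝕄 (diagK g)` vanishes when that block of `𝕄` does. -/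
theorem conjV_diagK_inr_inr_of_mm {𝕄 : MKer (d + 1) (Fib d)} (hmm : ∀ x z μ μ', 𝕄 x z (Sum.inr μ) (Sum.inr μ') = 0)
    (g : (Fin (d + 1) → ℤ) → Fib d → ℝ) (x z : Fin (d + 1) → ℤ) (μ μ' : Fin (d + 1)) :
    conjV 𝕄 (diagK g) x z (Sum.inr μ) (Sum.inr μ') = 0 := by
  rw [conjV_diagK_apply, hmm, zero_mul]

/-! ## §2 The vh-slice at a reflected jet bond against a bordered-shape `𝕄`, blockwise -/

section Blocks

variable (hLc : Odd Lc) (c : ℝ) {s : ℝ} (hs : s ≠ 0) {𝕄 : MKer (d + 1) (Fib d)}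
  (hfm : ∀ x z β μ, 𝕄 x z (Sum.inl β) (Sum.inr μ) = s * bhKAt d (ctr (d + 1) Lc) Lc x z (Sum.inl β) (Sum.inr μ))
  (hmf : ∀ x z μ β, 𝕄 x z (Sum.inr μ) (Sum.inl β) = s * bhKAt d (ctr (d + 1) Lc) Lc x z (Sum.inr μ) (Sum.inl β))
  (hmm : ∀ x z μ μ', 𝕄 x z (Sum.inr μ) (Sum.inr μ') = 0)
include hLc

section
include hs hfm

/-- [folklore] **FIELD–MULTIPLIER BLOCK** (every jet bond). -/
theorem smul_vhSAt_bref_inl_inr (α κ' : Fin (d + 1)) (u x z : Fin (d + 1) → ℤ) (β μ : Fin (d + 1)) :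
    (c • vhSAt (ctr (d + 1) Lc) d Lc rfl κ' (bref α κ' u)) x z (Sum.inl β) (Sum.inr μ) =
      (reflSign α κ' • refK (Φ Lc α) (c • vhSAt (ctr (d + 1) Lc) d Lc rfl κ' u +
        conjV 𝕄 ((c / (s * (Lc : ℝ) ^ (d + 1))) • diagK (ctGen d α Lc κ' u)))) x z (Sum.inl β) (Sum.inr μ) := by
  have hL : ((Lc : ℝ) ^ (d + 1)) ≠ 0 := pow_ne_zero _ (by exact_mod_cast NeZero.ne Lc)
  have hc : ∀ x' z', conjV 𝕄 (diagK (ctGen d α Lc κ' u)) x' z' (Sum.inl β) (Sum.inr μ) =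
      s * conjV (bhKAt d (ctr (d + 1) Lc) Lc) (diagK (ctGen d α Lc κ' u)) x' z' (Sum.inl β) (Sum.inr μ) :=
    fun x' z' => conjV_diagK_apply_of_entry _ (hfm x' z' β μ)
  rw [vhSAt_bref hLc]
  simp only [Pi.smul_apply, Pi.add_apply, Pi.sub_apply, smul_eq_mul, refK_apply, conjV_smul_right, Φ_r_inl, Φ_r_inr, hc,
    conjV_bhKAt_ctGen_inl_inr]
  field_simp
  ring

end

section
include hs hmf

/-- [folklore] **MULTIPLIER–FIELD BLOCK** (every jet bond). -/
theorem smul_vhSAt_bref_inr_inl (α κ' : Fin (d + 1)) (u x z : Fin (d + 1) → ℤ) (μ β : Fin (d + 1)) :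
    (c • vhSAt (ctr (d + 1) Lc) d Lc rfl κ' (bref α κ' u)) x z (Sum.inr μ) (Sum.inl β) =
      (reflSign α κ' • refK (Φ Lc α) (c • vhSAt (ctr (d + 1) Lc) d Lc rfl κ' u +
        conjV 𝕄 ((c / (s * (Lc : ℝ) ^ (d + 1))) • diagK (ctGen d α Lc κ' u)))) x z (Sum.inr μ) (Sum.inl β) := by
  have hL : ((Lc : ℝ) ^ (d + 1)) ≠ 0 := pow_ne_zero _ (by exact_mod_cast NeZero.ne Lc)
  have hc : ∀ x' z', conjV 𝕄 (diagK (ctGen d α Lc κ' u)) x' z' (Sum.inr μ) (Sum.inl β) =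
      s * conjV (bhKAt d (ctr (d + 1) Lc) Lc) (diagK (ctGen d α Lc κ' u)) x' z' (Sum.inr μ) (Sum.inl β) :=
    fun x' z' => conjV_diagK_apply_of_entry _ (hmf x' z' μ β)
  rw [vhSAt_bref hLc]
  simp only [Pi.smul_apply, Pi.add_apply, Pi.sub_apply, smul_eq_mul, refK_apply, conjV_smul_right, Φ_r_inl, Φ_r_inr, hc,
    conjV_bhKAt_ctGen_inr_inl]
  field_simp
  ring

end

section
include hmm

omit [NeZero Lc] in
/-- [folklore] MULTIPLIER–MULTIPLIER BLOCK: both sides vanish. -/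
theorem smul_vhSAt_bref_inr_inr (α κ' : Fin (d + 1)) (u x z : Fin (d + 1) → ℤ) (μ μ' : Fin (d + 1)) :
    (c • vhSAt (ctr (d + 1) Lc) d Lc rfl κ' (bref α κ' u)) x z (Sum.inr μ) (Sum.inr μ') =
      (reflSign α κ' • refK (Φ Lc α) (c • vhSAt (ctr (d + 1) Lc) d Lc rfl κ' u +
        conjV 𝕄 ((c / (s * (Lc : ℝ) ^ (d + 1))) • diagK (ctGen d α Lc κ' u)))) x z (Sum.inr μ) (Sum.inr μ') := by
  rw [vhSAt_bref hLc]
  simp only [Pi.smul_apply, Pi.add_apply, Pi.sub_apply, smul_eq_mul, refK_apply, conjV_smul_right, Φ_r_inr,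
    conjV_diagK_inr_inr_of_mm hmm, AveragingHessianKernelsRooted.vhSAt, packVH_inr_inr, mul_zero, sub_zero, add_zero]

end

omit [NeZero Lc] in
/-- [folklore] FIELD–FIELD BLOCK for a jet bond NOT parallel to the reflected axis: both sides vanish (any `𝕄`). -/
theorem smul_vhSAt_bref_inl_inl_of_ne {α κ' : Fin (d + 1)} (h : κ' ≠ α) (u x z : Fin (d + 1) → ℤ) (β β' : Fin (d + 1)) :
    (c • vhSAt (ctr (d + 1) Lc) d Lc rfl κ' (bref α κ' u)) x z (Sum.inl β) (Sum.inl β') =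
      (reflSign α κ' • refK (Φ Lc α) (c • vhSAt (ctr (d + 1) Lc) d Lc rfl κ' u +
        conjV 𝕄 ((c / (s * (Lc : ℝ) ^ (d + 1))) • diagK (ctGen d α Lc κ' u)))) x z (Sum.inl β) (Sum.inl β') := by
  rw [vhSAt_bref hLc]
  simp only [Pi.smul_apply, Pi.add_apply, Pi.sub_apply, smul_eq_mul, refK_apply, conjV_smul_right, Φ_r_inl,
    conjV_diagK_ctGen_inl_inl_of_ne' 𝕄 h, AveragingHessianKernelsRooted.vhSAt, packVH_inl_inl, mul_zero, sub_zero, add_zero]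

/-! ## §3 The socket shape for jet bonds off the reflected axis, every level -/

include hs hfm hmf hmm in
/-- [folklore] **THE vh-SLICE LAW AGAINST A BORDERED-SHAPE `𝕄`**: for `κ′ ≠ α`,
`c • vhSAt ρ_c κ′ (bref α κ′ u) = reflSign α κ′ • refK (Φ Lc α) (c • vhSAt ρ_c κ′ u + conjV 𝕄 ((c / (s·Lc^{d+1})) • diagK (ctGen d α Lc κ′ u)))`. -/
theorem smul_vhSAt_bref_of_ne {α κ' : Fin (d + 1)} (h : κ' ≠ α) (u : Fin (d + 1) → ℤ) :
    c • vhSAt (ctr (d + 1) Lc) d Lc rfl κ' (bref α κ' u) =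
      reflSign α κ' • refK (Φ Lc α) (c • vhSAt (ctr (d + 1) Lc) d Lc rfl κ' u +
        conjV 𝕄 ((c / (s * (Lc : ℝ) ^ (d + 1))) • diagK (ctGen d α Lc κ' u))) := by
  funext x z a b
  rcases a with β | μ <;> rcases b with β' | μ'
  · exact smul_vhSAt_bref_inl_inl_of_ne hLc c h u x z β β'
  · exact smul_vhSAt_bref_inl_inr hLc c hs hfm α κ' u x z β μ'
  · exact smul_vhSAt_bref_inr_inl hLc c hs hmf α κ' u x z μ β'
  · exact smul_vhSAt_bref_inr_inr hLc c hmm α κ' u x z μ μ'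

end Blocks

end Summit.QuantumFields.BalabanUV.Beta.SpineRooted

end
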